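import Literature.AlgebraicGeometry.Motives.DifferentialsLocallyFreeProofs
import Literature.AlgebraicGeometry.Modules.QuasicoherentAbelian
import HarnessLib

/-!
# The cotangent sheaf `Ω¹_{X/k}` is affine-localizing, hence quasi-coherent

For a `k`-scheme `X : Over (Spec k)` (any commutative ring `k`), the tree's cotangent sheaf
`Literature.AlgebraicGeometry.Motives.cotangentSheaf X` (`Motives/Differentials`, the sheafification
of `U ↦ Ω_{Γ(X,U)/k}`) satisfies the two localization conditions of Hartshorne II Lemma 5.3 on the
principal opens of every affine open — i.e. it is AFFINE-LOCALIZING in the sense of the tree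
(`Modules/AffineLocalizing.IsAffineLocalizing`) — because on an affine open `U = Spec B` its sections
are `Ω_{B/k}` (Hartshorne II Rem. 8.9.2, tree `bijective_toCotangentSheaf_app_holds`) and
`Ω_{B_g/k} = (Ω_{B/k})_g` (Hartshorne II Prop. 8.2A); the two conditions were proved pointwise in
`Motives/DifferentialsLocallyFreeProofs` (`cotangentSheaf_exists_pow_smul_eq_map`,
`cotangentSheaf_exists_pow_smul_eq_zero`). This file only PACKAGES them:

* `isAffineLocalizing_cotangentSheaf X : IsAffineLocalizing (cotangentSheaf X)`;
* `isQuasicoherent_cotangentSheaf X : (cotangentSheaf X).IsQuasicoherent` — Mathlib's quasi-coherence,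
  through the tree's bridge `isQuasicoherent_iff_isAffineLocalizing` (`Modules/QuasicoherentAbelian`).

These are the hypotheses under which the tree's chart engine for inverse images
(`Modules/PullbackAffineChart`: `Γ(U, f^*M) = Γ(U) ⊗_{Γ(V)} Γ(V, M)` for affine-localizing `M`) and
`Modules/PullbackQuasicoherent` apply to `Ω¹_{X/k}` (used by the product formula for `Ω¹` and by the
fibre of `Ω¹` at a rational point, cell `pub-hodge-ring2`, crux stmt-HodgeConjecture-26512, stub
`stub_cotangentSheafFree`). Everything is proved; no definitions, no named facts.

presearch: «Ω¹_{X/k} quasi-coherent» → [Hartshorne1977 II Rem. 8.9.2 + II Prop. 5.4] standard; tree had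
the two Lemma-5.3 conditions (`DifferentialsLocallyFreeProofs`) but not the packaged property (rg
`IsAffineLocalizing (cotangentSheaf`, `isQuasicoherent_cotangentSheaf`: 0 hits); corpus+galaxy not
needed (textbook).

## References

* R. Hartshorne, *Algebraic Geometry*, GTM 52 (1977), II Lemma 5.3, II Prop. 5.4, II Prop. 8.2A,
  II Remark 8.9.2. [Hartshorne1977]
-/

noncomputable section

open CategoryTheory AlgebraicGeometry TopologicalSpace Opposite

universe u

namespace Literature.AlgebraicGeometry.Motives

open Literature.AlgebraicGeometry.Modules

variable {k : Type u} [CommRing k] (X : Over (Spec (CommRingCat.of k)))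

-- `TopCat.Presheaf`/`TopCat.Sheaf` are not reducible: as in Mathlib's `AlgebraicGeometry.Modules`.
set_option backward.isDefEq.respectTransparency false in
/-- **`Ω¹_{X/k}` is affine-localizing**: on every affine open `V` and every `r ∈ Γ(V, 𝒪_X)`,
sections of `Ω¹_{X/k}` over `D(r)` are fractions `x|_{D(r)}/rⁿ`, and a section over `V` vanishing on
`D(r)` is killed by a power of `r` (Hartshorne II Lemma 5.3 (a), (b) for `Ω¹|_V = (Ω_{B/k})~`).
[cite: Hartshorne1977, II Lemma 5.3 and II Remark 8.9.2] -/
theorem isAffineLocalizing_cotangentSheaf : IsAffineLocalizing (cotangentSheaf X) := by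
  constructor
  · intro V hV r W hW s
    obtain ⟨n, y, h⟩ := cotangentSheaf_exists_pow_smul_eq_map X hV r hW
      (homOfLE (hW.trans_le (X.left.basicOpen_le r))) s
    exact ⟨n, y, h.symm⟩
  · intro V hV r x W hWV hrW hx
    -- restrict the vanishing `x|_W = 0` further to `D(r) ⊆ W`
    have h2 := congrArg ((cotangentSheaf X).presheaf.map (homOfLE hrW).op) hx
    rw [map_zero, ← CategoryTheory.comp_apply, ← Functor.map_comp] at h2
    have hx' : (cotangentSheaf X).val.map (homOfLE (hrW.trans hWV)).op x = 0 := by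
      have he : ((homOfLE hWV).op ≫ (homOfLE hrW).op : op V ⟶ op (X.left.basicOpen r)) =
          (homOfLE (hrW.trans hWV)).op := Subsingleton.elim _ _
      rw [he] at h2
      exact h2
    exact cotangentSheaf_exists_pow_smul_eq_zero X hV r rfl (homOfLE (hrW.trans hWV)) x hx'

/-- **`Ω¹_{X/k}` is quasi-coherent** (Mathlib's `SheafOfModules.IsQuasicoherent`), through the tree's
bridge «affine-localizing ⟺ quasi-coherent» (`Modules/QuasicoherentAbelian`).
[cite: Hartshorne1977, II Prop. 5.4 and II Remark 8.9.2] -/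
theorem isQuasicoherent_cotangentSheaf : (cotangentSheaf X).IsQuasicoherent :=
  isQuasicoherent_of_isAffineLocalizing (isAffineLocalizing_cotangentSheaf X)

end Literature.AlgebraicGeometry.Motives

end
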